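import Mathlib.Analysis.SpecialFunctions.Trigonometric.Deriv
import Mathlib.Analysis.SpecialFunctions.Trigonometric.ArctanDeriv
import Mathlib.Analysis.SpecialFunctions.SmoothTransition
import Mathlib.Analysis.Calculus.ContDiff.Operations
import HarnessLib

/-!
# The box `N` of Gompf's Theorem 2.1 in the shear model: a polar domain with flat top

In the proof of R. Gompf, *More Cappell–Shaneson spheres are standard*, Algebr. Geom. Topol. 10
(2010), Thm 2.1, the torus `T = {y = 0}` is replaced by `Ĉ × ∂D` where `D` is a small disc in the
`(y, s)`-plane below `y = 0` and `N = D × T²` is the box whose boundary carries the fibre bundle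
structure of Lemma 2.2. In the model (`GompfShearModel.lean`) we take for `D` a **polar domain with
flat top**: centre `c_N = (y⋆ - h, 3/4)`, boundary `c_N + R(θ)(sin θ, cos θ)` with
`R(θ) = h / sin θ` on the sector `|θ - π/2| ≤ φ₁` (so the top is the horizontal segment `y = y⋆`,
where Gompf's disc collar descends vertically onto `N`, `FishtailCoordinates.lean`), blended into a
constant radius `R₀` off `|θ - π/2| < φ₂`. The shell of `N` (the image of the box part of the
fishtail end) is the radial family `c_N + (1 - e) R(θ)(sin θ, cos θ)`, `e` the depth.

* `Literature.Topology.FourManifolds.thetaN t = π/2 + 2π(t - 1)` — the angle about `c_N` as a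
  function of the model base `t` (the seam `t ≡ 1` is the top point; `s` decreases in `t` near it,
  the orientation fixed in `FishtailLambda.lean`).
* `Literature.Topology.FourManifolds.topBump φ₁ φ₂` (a `2π`-periodic bump, a function of
  `sin θ`), `Literature.Topology.FourManifolds.boxR`, `Literature.Topology.FourManifolds.boxY`,
  `Literature.Topology.FourManifolds.boxS` with the **flat-sector identities** `boxY = y⋆ - h e`,
  `boxS = 3/4 - (1 - e) h tan(2π(t - 1))` (`boxY_flat`, `boxS_flat_thetaN`), smoothness
  (`contDiff_boxR`, …), positivity, and **injectivity of the radial shell**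
  `(θ mod 2π, e) ↦ (boxY, boxS)` for `e < 1` (`boxYS_inj`).

Everything is proved; no named facts.

## References

* R. E. Gompf, *More Cappell–Shaneson spheres are standard*, Algebr. Geom. Topol. 10 (2010)
  1665–1681, proof of Thm 2.1 (the disc `D ⊂ I_θ × I` and the box `N = D × T²`) and Lemma 2.2.
  [GompfAGT2010]
-/

noncomputable section

open scoped Real ContDiff Topology
open Set Function Filter

namespace Literature.Topology.FourManifolds

/-! ### The angle about the centre of the box -/

section Angle

/-- **The angle about the centre of the box** as a function of the model base: `θ_N(t) = π/2 + 2π(t - 1)`. [folklore] -/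
def thetaN (t : ℝ) : ℝ := π / 2 + 2 * π * (t - 1)

/-- `θ_N` is smooth (affine). [folklore] -/
theorem contDiff_thetaN : ContDiff ℝ ∞ thetaN :=
  contDiff_const.add (contDiff_const.mul (contDiff_id.sub contDiff_const))

/-- `θ_N 1 = π/2` (the seam is the top point). [folklore] -/
@[simp] theorem thetaN_one : thetaN 1 = π / 2 := by simp [thetaN]

/-- `sin θ_N(t) = cos(2π(t-1))`, `cos θ_N(t) = -sin(2π(t-1))`. [folklore] -/
theorem sin_thetaN (t : ℝ) : Real.sin (thetaN t) = Real.cos (2 * π * (t - 1)) := by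
  rw [thetaN, add_comm, Real.sin_add_pi_div_two]

/-- `cos θ_N(t) = -sin(2π(t-1))`. [folklore] -/
theorem cos_thetaN (t : ℝ) : Real.cos (thetaN t) = -Real.sin (2 * π * (t - 1)) := by
  rw [thetaN, add_comm, Real.cos_add_pi_div_two]

/-- Near the seam the sine of the angle is positive: `|t - 1| < 1/4 → 0 < sin θ_N(t)`. [folklore] -/
theorem sin_thetaN_pos {t : ℝ} (h1 : 3 / 4 < t) (h2 : t < 5 / 4) : 0 < Real.sin (thetaN t) := by
  rw [sin_thetaN]
  exact Real.cos_pos_of_mem_Ioo ⟨by nlinarith [Real.pi_pos], by nlinarith [Real.pi_pos]⟩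

end Angle

/-! ### The radius profile with flat top -/

section Radius

variable (h R₀ φ₁ φ₂ : ℝ)

/-- **The top bump**, a smooth `2π`-periodic function of the angle through `sin θ`:
`λ((sin θ - cos φ₂)/(cos φ₁ - cos φ₂))` — `1` where `sin θ ≥ cos φ₁` (the top sector
`|θ - π/2| ≤ φ₁ (mod 2π)`), `0` where `sin θ ≤ cos φ₂`. [folklore] -/
def topBump (φ₁ φ₂ θ : ℝ) : ℝ :=
  Real.smoothTransition ((Real.sin θ - Real.cos φ₂) / (Real.cos φ₁ - Real.cos φ₂))

/-- **The radius profile of the box**: `h / sin θ` on the top sector, `R₀` elsewhere, blended;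
a function of `sin θ` only. [cite: GompfAGT2010, Thm 2.1 (proof: the disc D ⊂ I_θ × I tangent to the front face)] -/
def boxR (θ : ℝ) : ℝ := topBump φ₁ φ₂ θ * (h / Real.sin θ) + (1 - topBump φ₁ φ₂ θ) * R₀

variable {h R₀ φ₁ φ₂}

/-- `cos φ₂ < cos φ₁` for `0 ≤ φ₁ < φ₂ ≤ π`. [folklore] -/
theorem cos_lt_cos_of_lt (hφ₁ : 0 ≤ φ₁) (hφ : φ₁ < φ₂) (hφ₂ : φ₂ ≤ π) : Real.cos φ₂ < Real.cos φ₁ :=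
  Real.cos_lt_cos_of_nonneg_of_le_pi hφ₁ hφ₂ hφ

/-- The bump is smooth. [folklore] -/
theorem contDiff_topBump (φ₁ φ₂ : ℝ) : ContDiff ℝ ∞ (topBump φ₁ φ₂) :=
  Real.smoothTransition.contDiff.comp ((Real.contDiff_sin.sub contDiff_const).div_const _)

/-- The bump depends on `θ` only through `sin θ`. [folklore] -/
theorem topBump_congr {θ θ' : ℝ} (hs : Real.sin θ = Real.sin θ') : topBump φ₁ φ₂ θ = topBump φ₁ φ₂ θ' := by
  rw [topBump, topBump, hs]

/-- Where `sin θ ≥ cos φ₁` the bump is `1` (`0 ≤ φ₁ < φ₂ ≤ π`). [folklore] -/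
theorem topBump_eq_one (hφ₁ : 0 ≤ φ₁) (hφ : φ₁ < φ₂) (hφ₂ : φ₂ ≤ π) {θ : ℝ} (hθ : Real.cos φ₁ ≤ Real.sin θ) :
    topBump φ₁ φ₂ θ = 1 :=
  Real.smoothTransition.one_of_one_le ((one_le_div (sub_pos.2 (cos_lt_cos_of_lt hφ₁ hφ hφ₂))).2 (by linarith))

/-- Where `sin θ ≤ cos φ₂` the bump is `0`. [folklore] -/
theorem topBump_eq_zero (hφ₁ : 0 ≤ φ₁) (hφ : φ₁ < φ₂) (hφ₂ : φ₂ ≤ π) {θ : ℝ} (hθ : Real.sin θ ≤ Real.cos φ₂) :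
    topBump φ₁ φ₂ θ = 0 :=
  Real.smoothTransition.zero_of_nonpos (div_nonpos_of_nonpos_of_nonneg (by linarith)
    (sub_pos.2 (cos_lt_cos_of_lt hφ₁ hφ hφ₂)).le)

/-- On the top sector `|θ - π/2| ≤ φ₁` one has `cos φ₁ ≤ sin θ`. [folklore] -/
theorem cos_le_sin_of_abs_le {θ : ℝ} (hφ₁ : φ₁ ≤ π) (hθ : |θ - π / 2| ≤ φ₁) : Real.cos φ₁ ≤ Real.sin θ := by
  rw [← Real.cos_sub_pi_div_two, ← Real.cos_abs (θ - π / 2)]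
  exact Real.cos_le_cos_of_nonneg_of_le_pi (abs_nonneg _) hφ₁ hθ

/-- The bump takes values in `[0, 1]`. [folklore] -/
theorem topBump_mem (φ₁ φ₂ θ : ℝ) : topBump φ₁ φ₂ θ ∈ Icc (0 : ℝ) 1 :=
  ⟨Real.smoothTransition.nonneg _, Real.smoothTransition.le_one _⟩

/-- **On the top sector the radius is `h / sin θ`.** [folklore] -/
theorem boxR_of_abs_le (hφ₁ : 0 ≤ φ₁) (hφ : φ₁ < φ₂) (hφ₂ : φ₂ ≤ π) {θ : ℝ} (hθ : |θ - π / 2| ≤ φ₁) :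
    boxR h R₀ φ₁ φ₂ θ = h / Real.sin θ := by
  rw [boxR, topBump_eq_one hφ₁ hφ hφ₂ (cos_le_sin_of_abs_le (hφ.le.trans hφ₂) hθ)]; ring

/-- Where `sin θ ≤ cos φ₂` the radius is `R₀`. [folklore] -/
theorem boxR_of_sin_le (hφ₁ : 0 ≤ φ₁) (hφ : φ₁ < φ₂) (hφ₂ : φ₂ ≤ π) {θ : ℝ} (hθ : Real.sin θ ≤ Real.cos φ₂) :
    boxR h R₀ φ₁ φ₂ θ = R₀ := by
  rw [boxR, topBump_eq_zero hφ₁ hφ hφ₂ hθ]; ring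

/-- The radius profile depends on `θ` only through `sin θ`. [folklore] -/
theorem boxR_congr {θ θ' : ℝ} (hs : Real.sin θ = Real.sin θ') : boxR h R₀ φ₁ φ₂ θ = boxR h R₀ φ₁ φ₂ θ' := by
  rw [boxR, boxR, topBump_congr hs, hs]

/-- **The radius profile is smooth** (`0 ≤ φ₁ < φ₂ < π/2`): where `sin θ ≠ 0` both branches are
smooth, and near a zero of `sin` (where `sin < cos φ₂`) the profile is locally `R₀`. [folklore] -/
theorem contDiff_boxR (hφ₁ : 0 ≤ φ₁) (hφ : φ₁ < φ₂) (hφ₂ : φ₂ < π / 2) : ContDiff ℝ ∞ (boxR h R₀ φ₁ φ₂) := by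
  have hc : 0 < Real.cos φ₂ := Real.cos_pos_of_mem_Ioo ⟨by linarith, hφ₂⟩
  rw [contDiff_iff_contDiffAt]
  intro θ
  by_cases hs : Real.sin θ < Real.cos φ₂
  · have hev : boxR h R₀ φ₁ φ₂ =ᶠ[𝓝 θ] fun _ ↦ R₀ := by
      filter_upwards [(isOpen_lt Real.continuous_sin continuous_const).mem_nhds hs] with θ' hθ'
      exact boxR_of_sin_le hφ₁ hφ (by linarith) hθ'.le
    exact contDiffAt_const.congr_of_eventuallyEq hev
  · have hs0 : Real.sin θ ≠ 0 := by intro h0; rw [h0] at hs; exact hs hc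
    have hb := (contDiff_topBump φ₁ φ₂).contDiffAt (x := θ)
    exact (hb.mul (contDiffAt_const.div Real.contDiff_sin.contDiffAt hs0)).add
      ((contDiffAt_const.sub hb).mul contDiffAt_const)

/-- The radius profile is positive when `h, R₀ > 0` and `0 ≤ φ₁ < φ₂ < π/2` (where the bump is
nonzero, `sin θ > cos φ₂ > 0`). [folklore] -/
theorem boxR_pos (hh : 0 < h) (hR : 0 < R₀) (hφ₁ : 0 ≤ φ₁) (hφ : φ₁ < φ₂) (hφ₂ : φ₂ < π / 2) (θ : ℝ) :
    0 < boxR h R₀ φ₁ φ₂ θ := by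
  have hc : 0 < Real.cos φ₂ := Real.cos_pos_of_mem_Ioo ⟨by linarith, hφ₂⟩
  rcases le_or_gt (Real.sin θ) (Real.cos φ₂) with hfar | hnear
  · rw [boxR_of_sin_le hφ₁ hφ (by linarith) hfar]; exact hR
  · have hsin : 0 < Real.sin θ := hc.trans hnear
    have hb := topBump_mem φ₁ φ₂ θ
    rw [boxR]
    have h1 : 0 < h / Real.sin θ := div_pos hh hsin
    rcases eq_or_lt_of_le hb.1 with h0 | h0
    · rw [← h0]; linarith
    · nlinarith [hb.2, mul_pos h0 h1]

end Radius

/-! ### The radial shell -/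

section Shell

variable (ystar h R₀ φ₁ φ₂ : ℝ)

/-- **The height of the shell point**: `y = (y⋆ - h) + (1 - e) R(θ) sin θ`. [folklore] -/
def boxY (θ e : ℝ) : ℝ := (ystar - h) + (1 - e) * boxR h R₀ φ₁ φ₂ θ * Real.sin θ

/-- **The base coordinate of the shell point**: `s = 3/4 + (1 - e) R(θ) cos θ`. [folklore] -/
def boxS (θ e : ℝ) : ℝ := 3 / 4 + (1 - e) * boxR h R₀ φ₁ φ₂ θ * Real.cos θ

variable {ystar h R₀ φ₁ φ₂}

/-- **Flat top**: on the top sector `y = y⋆ - h e` (the depth `e` level is horizontal). [cite: GompfAGT2010, Thm 2.1 (proof: D tangent to I_θ × {0})] -/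
theorem boxY_flat (hφ₁ : 0 ≤ φ₁) (hφ : φ₁ < φ₂) (hφ₂ : φ₂ < π / 2) {θ : ℝ} (hθ : |θ - π / 2| ≤ φ₁) (e : ℝ) :
    boxY ystar h R₀ φ₁ φ₂ θ e = ystar - h * e := by
  have hsin : Real.sin θ ≠ 0 := by
    have hc : 0 < Real.cos φ₁ := Real.cos_pos_of_mem_Ioo ⟨by linarith, by linarith⟩
    exact (hc.trans_le (cos_le_sin_of_abs_le (by linarith) hθ)).ne'
  rw [boxY, boxR_of_abs_le hφ₁ hφ (by linarith) hθ]
  field_simp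
  ring

/-- On the top sector `s = 3/4 + (1 - e) h cos θ / sin θ`. [folklore] -/
theorem boxS_flat (hφ₁ : 0 ≤ φ₁) (hφ : φ₁ < φ₂) (hφ₂ : φ₂ < π / 2) {θ : ℝ} (hθ : |θ - π / 2| ≤ φ₁) (e : ℝ) :
    boxS h R₀ φ₁ φ₂ θ e = 3 / 4 + (1 - e) * h * (Real.cos θ / Real.sin θ) := by
  rw [boxS, boxR_of_abs_le hφ₁ hφ (by linarith) hθ]
  ring

/-- **The top read from the model base**: on the top sector,
`boxS (θ_N t) e = 3/4 - (1 - e) h tan(2π(t - 1))`. [folklore] -/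
theorem boxS_flat_thetaN (hφ₁ : 0 ≤ φ₁) (hφ : φ₁ < φ₂) (hφ₂ : φ₂ < π / 2) {t : ℝ}
    (hθ : |thetaN t - π / 2| ≤ φ₁) (e : ℝ) :
    boxS h R₀ φ₁ φ₂ (thetaN t) e = 3 / 4 - (1 - e) * h * Real.tan (2 * π * (t - 1)) := by
  rw [boxS_flat hφ₁ hφ hφ₂ hθ, sin_thetaN, cos_thetaN, Real.tan_eq_sin_div_cos]
  ring

/-- `|θ_N(t) - π/2| = 2π |t - 1|`. [folklore] -/
theorem abs_thetaN_sub (t : ℝ) : |thetaN t - π / 2| = 2 * π * |t - 1| := by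
  rw [thetaN, show π / 2 + 2 * π * (t - 1) - π / 2 = 2 * π * (t - 1) by ring, abs_mul,
    abs_of_pos (by positivity : (0 : ℝ) < 2 * π)]

/-- The shell coordinates are smooth in `(θ, e)`. [folklore] -/
theorem contDiff_boxYS (hφ₁ : 0 ≤ φ₁) (hφ : φ₁ < φ₂) (hφ₂ : φ₂ < π / 2) :
    ContDiff ℝ ∞ fun p : ℝ × ℝ ↦ (boxY ystar h R₀ φ₁ φ₂ p.1 p.2, boxS h R₀ φ₁ φ₂ p.1 p.2) := by
  have hR : ContDiff ℝ ∞ fun p : ℝ × ℝ ↦ boxR h R₀ φ₁ φ₂ p.1 := (contDiff_boxR hφ₁ hφ hφ₂).comp contDiff_fst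
  have he : ContDiff ℝ ∞ fun p : ℝ × ℝ ↦ (1 : ℝ) - p.2 := contDiff_const.sub contDiff_snd
  exact (contDiff_const.add ((he.mul hR).mul (Real.contDiff_sin.comp contDiff_fst))).prodMk
    (contDiff_const.add ((he.mul hR).mul (Real.contDiff_cos.comp contDiff_fst)))

/-- **Injectivity of the radial shell**: if `(boxY, boxS)` agree for `(θ, e)`, `(θ', e')` with
`e, e' < 1`, then `e = e'` and `θ ≡ θ'` in the sense `cos θ = cos θ'`, `sin θ = sin θ'` — the
shell point determines its offset `(1 - e) R(θ) (sin θ, cos θ)` from `c_N`, hence the direction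
and (since `R` is a function of the direction) the depth. [folklore] -/
theorem boxYS_inj (hh : 0 < h) (hR : 0 < R₀) (hφ₁ : 0 ≤ φ₁) (hφ : φ₁ < φ₂) (hφ₂ : φ₂ < π / 2)
    {θ θ' e e' : ℝ} (he : e < 1) (he' : e' < 1)
    (hY : boxY ystar h R₀ φ₁ φ₂ θ e = boxY ystar h R₀ φ₁ φ₂ θ' e')
    (hS : boxS h R₀ φ₁ φ₂ θ e = boxS h R₀ φ₁ φ₂ θ' e') :
    e = e' ∧ Real.cos θ = Real.cos θ' ∧ Real.sin θ = Real.sin θ' := by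
  set r := (1 - e) * boxR h R₀ φ₁ φ₂ θ with hr
  set r' := (1 - e') * boxR h R₀ φ₁ φ₂ θ' with hr'
  have hRp := boxR_pos hh hR hφ₁ hφ hφ₂ θ
  have hRp' := boxR_pos hh hR hφ₁ hφ hφ₂ θ'
  have hrp : 0 < r := mul_pos (by linarith) hRp
  have hrp' : 0 < r' := mul_pos (by linarith) hRp'
  have h1 : r * Real.sin θ = r' * Real.sin θ' := by
    have := hY; rw [boxY, boxY] at this; linarith
  have h2 : r * Real.cos θ = r' * Real.cos θ' := by
    have := hS; rw [boxS, boxS] at this; linarith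
  have hrr : r = r' := by
    have hsq : r ^ 2 = r' ^ 2 := by
      calc r ^ 2 = (r * Real.sin θ) ^ 2 + (r * Real.cos θ) ^ 2 := by
            linear_combination (-r ^ 2) * Real.sin_sq_add_cos_sq θ
        _ = (r' * Real.sin θ') ^ 2 + (r' * Real.cos θ') ^ 2 := by rw [h1, h2]
        _ = r' ^ 2 := by linear_combination (r' ^ 2) * Real.sin_sq_add_cos_sq θ'
    nlinarith
  have hc : Real.cos θ = Real.cos θ' := by
    rw [← hrr] at h2; exact mul_left_cancel₀ hrp.ne' h2
  have hs : Real.sin θ = Real.sin θ' := by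
    rw [← hrr] at h1; exact mul_left_cancel₀ hrp.ne' h1
  refine ⟨?_, hc, hs⟩
  have hRR : boxR h R₀ φ₁ φ₂ θ = boxR h R₀ φ₁ φ₂ θ' := boxR_congr hs
  have h3 : (1 - e) * boxR h R₀ φ₁ φ₂ θ = (1 - e') * boxR h R₀ φ₁ φ₂ θ := by rw [← hr, hrr, hr', hRR]
  have h4 := mul_right_cancel₀ hRp.ne' h3
  linarith

end Shell

end Literature.Topology.FourManifolds
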